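import Summits.Ventures.PercRepro.Concavity6

/-!
# PercRepro — Lemma 5: the concavity lemma along a MARK-INCIDENT edge, and its two halves (typer-2, gen 3)

`proofs/LEAD-C011-concavity.md` §8 and §10 (lead g3): the edge induction for C-011 only needs
concavity along ONE edge per `(G, p)`, chosen incident to a mark `a` (§8 steps (0)–(3)); so the
6-mark inequality of §3 is only needed for `g = a–v` with `a` marked — **Lemma 5** —
and Lemma 5 splits into two inequalities sorted by whether `a` is attached to another mark:

* the refined types: `typeCa i` (`{a, q} & {s}`: the endpoint `u` attached to the connected block),
  `typeCv i` (`{a} & {p′, q′}`: `u` attached to the singleton, `v` to the connected block);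
  `typeEv` (`{a} & {b, c, d}`), `typeEa` (`a` in the 3-set); `typeC i = typeCa i ∪ typeCv i`,
  `typeE = typeEa ∪ typeEv` (disjoint unions);
* **`Concavity5Mark`**: §3 for edges `g` with `G.fst g = a ∨ G.snd g = a`;
  `Concavity5Mark_of_Concavity6Mark`;
* **`Concavity5a`** (Block I, `a` isolated from the other marks on both sides):
  `½ Σ P(B_q)P(B_q′) + Σ P(B_q)P(C^v_q′) ≤ Σ P(A_q)P(B_q′) + P(A)P(E^v)`;
* **`Concavity5b`** (REST):
  `Σ P(B_q)P(C^a_q′) ≤ Σ P(A_q)P(D_q) + P(A)P(E^a) + Σ P(C^v_q)P(D_q′) + Σ P(C^a_q)P(D_q′)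
  + ½ Σ P(D_q)P(D_q′)`;
* `MultiGraph.flipEdge` (exchange the endpoints of `g`; the types `A`–`E` are flip-invariant);
* **`Concavity5Mark_of_5a_5b`**: their sum is Lemma 5 (5a / 5b are stated for the orientation
  `G.fst g = a`; the other orientation is the flipped graph).
The choose-the-edge induction `C011 ⇐ Concavity5Mark` (§8) is a separate file.
-/

namespace PercRepro

open Finset

namespace MultiGraph

variable {V E : Type*} (G : MultiGraph V E) [DecidableEq E]

section Types

variable (g : E) (a b c d : V)

/-- **Type `C^a_i`** (`{p, q} & {s}` with the endpoint `u` on the connected block): the block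
`{p, q}` of `xᵢ` is connected, the other two marks are separate, `u ~ p` and `v` attached to one of
the other two marks — or the same with the roles of the two blocks exchanged. When `u = a` this is
the lead's `C^a_q`: `a` attached to its partner `q`. -/
def typeCa (i : Fin 3) : Set (Config E) :=
  {ω | (G.isRank1Cell g ω (crossBlocks a b c d i).1.1 (crossBlocks a b c d i).1.2
          (crossBlocks a b c d i).2.1 (crossBlocks a b c d i).2.2 ∧
        G.ConnWithout g ω (G.fst g) (crossBlocks a b c d i).1.1 ∧
        (G.ConnWithout g ω (G.snd g) (crossBlocks a b c d i).2.1 ∨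
          G.ConnWithout g ω (G.snd g) (crossBlocks a b c d i).2.2)) ∨
       (G.isRank1Cell g ω (crossBlocks a b c d i).2.1 (crossBlocks a b c d i).2.2
          (crossBlocks a b c d i).1.1 (crossBlocks a b c d i).1.2 ∧
        G.ConnWithout g ω (G.fst g) (crossBlocks a b c d i).2.1 ∧
        (G.ConnWithout g ω (G.snd g) (crossBlocks a b c d i).1.1 ∨
          G.ConnWithout g ω (G.snd g) (crossBlocks a b c d i).1.2))}

/-- **Type `C^v_i`** (`{s} & {p, q}` with the endpoint `u` on a singleton and `v` on the connected
block). When `u = a` this is the lead's `C^v_q`: `a` alone, `v` attached to the connected pair. -/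
def typeCv (i : Fin 3) : Set (Config E) :=
  {ω | (G.isRank1Cell g ω (crossBlocks a b c d i).1.1 (crossBlocks a b c d i).1.2
          (crossBlocks a b c d i).2.1 (crossBlocks a b c d i).2.2 ∧
        G.ConnWithout g ω (G.snd g) (crossBlocks a b c d i).1.1 ∧
        (G.ConnWithout g ω (G.fst g) (crossBlocks a b c d i).2.1 ∨
          G.ConnWithout g ω (G.fst g) (crossBlocks a b c d i).2.2)) ∨
       (G.isRank1Cell g ω (crossBlocks a b c d i).2.1 (crossBlocks a b c d i).2.2
          (crossBlocks a b c d i).1.1 (crossBlocks a b c d i).1.2 ∧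
        G.ConnWithout g ω (G.snd g) (crossBlocks a b c d i).2.1 ∧
        (G.ConnWithout g ω (G.fst g) (crossBlocks a b c d i).1.1 ∨
          G.ConnWithout g ω (G.fst g) (crossBlocks a b c d i).1.2))}

/-- **Type `E^v`**: the marked partition is `bcd|a` and `u ~ a`, `v ~ b` (the endpoint `u` on the
singleton `a`). -/
def typeEv : Set (Config E) :=
  {ω | G.isThreeOneCell g ω b c d a ∧ G.ConnWithout g ω (G.fst g) a ∧ G.ConnWithout g ω (G.snd g) b}

/-- **Type `E^a`**: every other `3|1` attachment — the singleton is `b`, `c` or `d`, or it is `a`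
with `u` on the 3-set. -/
def typeEa : Set (Config E) :=
  {ω | (G.isThreeOneCell g ω b c d a ∧ G.ConnWithout g ω (G.fst g) b ∧ G.ConnWithout g ω (G.snd g) a) ∨
       (G.isThreeOneCell g ω a c d b ∧ G.linksPair g ω a b) ∨
       (G.isThreeOneCell g ω a b d c ∧ G.linksPair g ω a c) ∨
       (G.isThreeOneCell g ω a b c d ∧ G.linksPair g ω a d)}

/-- `C_i = C^a_i ∪ C^v_i`. -/
theorem typeC_eq_union (i : Fin 3) :
    G.typeC g a b c d i = G.typeCa g a b c d i ∪ G.typeCv g a b c d i := by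
  ext ω
  simp only [typeC, typeCa, typeCv, linksPair, Set.mem_setOf_eq, Set.mem_union]
  tauto

/-- `C^a_i` and `C^v_i` are disjoint (in `C^a` the endpoint `u` lies in the connected block, in
`C^v` in a singleton). -/
theorem disjoint_typeCa_typeCv (i : Fin 3) :
    Disjoint (G.typeCa g a b c d i) (G.typeCv g a b c d i) := by
  rw [Set.disjoint_left]
  intro ω h1 h2
  simp only [typeCa, typeCv, isRank1Cell, Set.mem_setOf_eq] at h1 h2
  rcases h1 with ⟨⟨hpq, hps, hps', hqs, hqs', hss'⟩, hu, hv⟩ |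
    ⟨⟨hpq, hps, hps', hqs, hqs', hss'⟩, hu, hv⟩ <;>
  rcases h2 with ⟨⟨hpq', -, -, -, -, -⟩, -, hu'⟩ | ⟨⟨hpq', -, -, -, -, -⟩, -, hu'⟩
  · rcases hu' with hu' | hu'
    · exact hps ((hu.symm).trans hu')
    · exact hps' ((hu.symm).trans hu')
  · exact hss' hpq'
  · exact hss' hpq'
  · rcases hu' with hu' | hu'
    · exact hps ((hu.symm).trans hu')
    · exact hps' ((hu.symm).trans hu')

/-- `E = E^a ∪ E^v`. -/
theorem typeE_eq_union : G.typeE g a b c d = G.typeEa g a b c d ∪ G.typeEv g a b c d := by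
  ext ω
  simp only [typeE, typeEa, typeEv, linksPair, Set.mem_setOf_eq, Set.mem_union]
  constructor
  · rintro (⟨h1, h2 | h2⟩ | h | h | h)
    · exact Or.inl (Or.inl ⟨h1, h2⟩)
    · exact Or.inr ⟨h1, h2⟩
    · exact Or.inl (Or.inr (Or.inl h))
    · exact Or.inl (Or.inr (Or.inr (Or.inl h)))
    · exact Or.inl (Or.inr (Or.inr (Or.inr h)))
  · rintro ((⟨h1, h2⟩ | h | h | h) | ⟨h1, h2⟩)
    · exact Or.inl ⟨h1, Or.inl h2⟩
    · exact Or.inr (Or.inl h)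
    · exact Or.inr (Or.inr (Or.inl h))
    · exact Or.inr (Or.inr (Or.inr h))
    · exact Or.inl ⟨h1, Or.inr h2⟩

/-- `E^a` and `E^v` are disjoint. -/
theorem disjoint_typeEa_typeEv : Disjoint (G.typeEa g a b c d) (G.typeEv g a b c d) := by
  rw [Set.disjoint_left]
  intro ω h1 h2
  simp only [typeEa, typeEv, isThreeOneCell, linksPair, Set.mem_setOf_eq] at h1 h2
  obtain ⟨⟨hbc, hcd, hba⟩, hua, hvb⟩ := h2
  rcases h1 with ⟨-, hub, -⟩ | ⟨⟨hac, -, -⟩, -⟩ | ⟨⟨hab, -, -⟩, -⟩ | ⟨⟨hab, -, -⟩, -⟩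
  · exact hba ((hub.symm).trans hua)
  · exact hba ((hbc.trans hac.symm))
  · exact hba hab.symm
  · exact hba hab.symm

end Types

end MultiGraph

/-- **Lemma 5** (`LEAD-C011-concavity.md` §8): the 6-mark inequality of §3 for the edges `g` with a
MARKED endpoint `a` (the marks distinct). With the choose-the-edge induction of §8 this is all the
concavity C-011 needs. -/
def Concavity5Mark : Prop :=
  ∀ {V E : Type} [Fintype E] [DecidableEq E] (G : MultiGraph V E) (p : E → ℝ), IsProb p →
    ∀ (a b c d : V), [a, b, c, d].Nodup → ∀ g : E, G.fst g = a ∨ G.snd g = a →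
      (1 / 2 : ℝ) * (∑ i : Fin 3, ∑ j : Fin 3, if i ≠ j then
          prob p (G.typeB g a b c d i) * prob p (G.typeB g a b c d j) else 0) +
        (∑ i : Fin 3, ∑ j : Fin 3, if i ≠ j then
          prob p (G.typeB g a b c d i) * prob p (G.typeC g a b c d j) else 0) ≤
      (∑ i : Fin 3, ∑ j : Fin 3, if i ≠ j then
          prob p (G.typeA g a b c d i) * prob p (G.typeB g a b c d j) else 0) +
        (∑ i : Fin 3, prob p (G.typeA g a b c d i) * prob p (G.typeD g a b c d i)) +
        (∑ i : Fin 3, prob p (G.typeA g a b c d i)) * prob p (G.typeE g a b c d) +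
        (∑ i : Fin 3, ∑ j : Fin 3, if i ≠ j then
          prob p (G.typeC g a b c d i) * prob p (G.typeD g a b c d j) else 0) +
        (1 / 2 : ℝ) * (∑ i : Fin 3, ∑ j : Fin 3, if i ≠ j then
          prob p (G.typeD g a b c d i) * prob p (G.typeD g a b c d j) else 0)

/-- Lemma 5 is the mark-incident case of the 6-mark inequality. -/
theorem Concavity5Mark_of_Concavity6Mark (h : Concavity6Mark) : Concavity5Mark :=
  fun G p hp a b c d _ g _ => h G p hp a b c d g

/-- **Lemma 5a** (§10, Block I — `a` isolated from the other marks on both sides; the edge is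
oriented `g = (a, v)`, i.e. `G.fst g = a` — the refined types `C^a`, `C^v`, `E^a`, `E^v` read the
endpoint `u = G.fst g` as `a`):
`½ Σ_{q≠q′} P(B_q)P(B_q′) + Σ_{q≠q′} P(B_q)P(C^v_q′) ≤ Σ_{q≠q′} P(A_q)P(B_q′) + P(A)·P(E^v)`. -/
def Concavity5a : Prop :=
  ∀ {V E : Type} [Fintype E] [DecidableEq E] (G : MultiGraph V E) (p : E → ℝ), IsProb p →
    ∀ (a b c d : V), [a, b, c, d].Nodup → ∀ g : E, G.fst g = a →
      (1 / 2 : ℝ) * (∑ i : Fin 3, ∑ j : Fin 3, if i ≠ j then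
          prob p (G.typeB g a b c d i) * prob p (G.typeB g a b c d j) else 0) +
        (∑ i : Fin 3, ∑ j : Fin 3, if i ≠ j then
          prob p (G.typeB g a b c d i) * prob p (G.typeCv g a b c d j) else 0) ≤
      (∑ i : Fin 3, ∑ j : Fin 3, if i ≠ j then
          prob p (G.typeA g a b c d i) * prob p (G.typeB g a b c d j) else 0) +
        (∑ i : Fin 3, prob p (G.typeA g a b c d i)) * prob p (G.typeEv g a b c d)

/-- **Lemma 5b** (§10, REST — `a` attached to another mark on at least one side; oriented
`G.fst g = a` as in `Concavity5a`):
`Σ_{q≠q′} P(B_q)P(C^a_q′) ≤ Σ_q P(A_q)P(D_q) + P(A)·P(E^a) + Σ_{q≠q′} P(C^v_q)P(D_q′)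
+ Σ_{q≠q′} P(C^a_q)P(D_q′) + ½ Σ_{q≠q′} P(D_q)P(D_q′)`. -/
def Concavity5b : Prop :=
  ∀ {V E : Type} [Fintype E] [DecidableEq E] (G : MultiGraph V E) (p : E → ℝ), IsProb p →
    ∀ (a b c d : V), [a, b, c, d].Nodup → ∀ g : E, G.fst g = a →
      (∑ i : Fin 3, ∑ j : Fin 3, if i ≠ j then
          prob p (G.typeB g a b c d i) * prob p (G.typeCa g a b c d j) else 0) ≤
      (∑ i : Fin 3, prob p (G.typeA g a b c d i) * prob p (G.typeD g a b c d i)) +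
        (∑ i : Fin 3, prob p (G.typeA g a b c d i)) * prob p (G.typeEa g a b c d) +
        (∑ i : Fin 3, ∑ j : Fin 3, if i ≠ j then
          prob p (G.typeCv g a b c d i) * prob p (G.typeD g a b c d j) else 0) +
        (∑ i : Fin 3, ∑ j : Fin 3, if i ≠ j then
          prob p (G.typeCa g a b c d i) * prob p (G.typeD g a b c d j) else 0) +
        (1 / 2 : ℝ) * (∑ i : Fin 3, ∑ j : Fin 3, if i ≠ j then
          prob p (G.typeD g a b c d i) * prob p (G.typeD g a b c d j) else 0)

namespace MultiGraph

variable {V E : Type*} (G : MultiGraph V E) [DecidableEq E]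

/-- The multigraph with the two endpoints of the edge `g` exchanged. -/
def flipEdge (g : E) : MultiGraph V E where
  fst e := if e = g then G.snd g else G.fst e
  snd e := if e = g then G.fst g else G.snd e

/-- The first endpoint of `g` after the flip. -/
theorem flipEdge_fst_self (g : E) : (G.flipEdge g).fst g = G.snd g := by simp [flipEdge]

/-- The second endpoint of `g` after the flip. -/
theorem flipEdge_snd_self (g : E) : (G.flipEdge g).snd g = G.fst g := by simp [flipEdge]

/-- Open adjacency does not see the orientation of an edge. -/
theorem flipEdge_openAdj (g : E) (ω : Config E) (x y : V) :
    (G.flipEdge g).OpenAdj ω x y ↔ G.OpenAdj ω x y := by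
  constructor <;> rintro ⟨e, he, h⟩ <;> refine ⟨e, he, ?_⟩ <;> by_cases heg : e = g <;>
    simp only [flipEdge, heg, if_true, if_false] at h ⊢ <;> tauto

/-- Connectivity does not see the orientation of an edge. -/
theorem flipEdge_conn (g : E) (ω : Config E) (x y : V) :
    (G.flipEdge g).Conn ω x y ↔ G.Conn ω x y := by
  unfold Conn
  constructor <;> intro h
  · exact Relation.ReflTransGen.mono (fun a b hab => (G.flipEdge_openAdj g ω a b).mp hab) _ _ h
  · exact Relation.ReflTransGen.mono (fun a b hab => (G.flipEdge_openAdj g ω a b).mpr hab) _ _ h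

/-- `ConnWithout` does not see the orientation of an edge. -/
theorem flipEdge_connWithout (g g' : E) (ω : Config E) (x y : V) :
    (G.flipEdge g).ConnWithout g' ω x y ↔ G.ConnWithout g' ω x y :=
  G.flipEdge_conn g _ x y

variable (g : E) (a b c d : V)

/-- `linksPair` is symmetric in the two endpoints, hence flip-invariant. -/
theorem flipEdge_linksPair (ω : Config E) (p q : V) :
    (G.flipEdge g).linksPair g ω p q ↔ G.linksPair g ω p q := by
  simp only [linksPair, flipEdge_connWithout, flipEdge_fst_self, flipEdge_snd_self]
  tauto

/-- The types `A`–`E` are invariant under flipping `g` (`linksPair` is symmetric in `u, v`). -/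
theorem flipEdge_typeA (i : Fin 3) : (G.flipEdge g).typeA g a b c d i = G.typeA g a b c d i := by
  ext ω
  simp only [typeA, sepAllFour, Set.mem_setOf_eq, flipEdge_connWithout, flipEdge_linksPair]

/-- `B` is flip-invariant. -/
theorem flipEdge_typeB (i : Fin 3) : (G.flipEdge g).typeB g a b c d i = G.typeB g a b c d i := by
  ext ω
  simp only [typeB, isRank1Cell, Set.mem_setOf_eq, flipEdge_connWithout, flipEdge_linksPair]

/-- `C` is flip-invariant. -/
theorem flipEdge_typeC (i : Fin 3) : (G.flipEdge g).typeC g a b c d i = G.typeC g a b c d i := by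
  ext ω
  simp only [typeC, isRank1Cell, Set.mem_setOf_eq, flipEdge_connWithout, flipEdge_linksPair]

/-- `D` is flip-invariant. -/
theorem flipEdge_typeD (i : Fin 3) : (G.flipEdge g).typeD g a b c d i = G.typeD g a b c d i := by
  ext ω
  simp only [typeD, isCrossCell, Set.mem_setOf_eq, flipEdge_connWithout, flipEdge_linksPair]

/-- `E` is flip-invariant. -/
theorem flipEdge_typeE : (G.flipEdge g).typeE g a b c d = G.typeE g a b c d := by
  ext ω
  simp only [typeE, isThreeOneCell, Set.mem_setOf_eq, flipEdge_connWithout, flipEdge_linksPair]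

end MultiGraph

/-- **Lemma 5 = Lemma 5a + Lemma 5b** for the oriented edges `G.fst g = a`
(`P(C) = P(C^a) + P(C^v)`, `P(E) = P(E^a) + P(E^v)`). -/
theorem concavity5_of_5a_5b_fst (ha : Concavity5a) (hb : Concavity5b) {V E : Type} [Fintype E]
    [DecidableEq E] (G : MultiGraph V E) (p : E → ℝ) (hp : IsProb p) (a b c d : V)
    (hn : [a, b, c, d].Nodup) (g : E) (hg : G.fst g = a) :
    (1 / 2 : ℝ) * (∑ i : Fin 3, ∑ j : Fin 3, if i ≠ j then
        prob p (G.typeB g a b c d i) * prob p (G.typeB g a b c d j) else 0) +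
      (∑ i : Fin 3, ∑ j : Fin 3, if i ≠ j then
        prob p (G.typeB g a b c d i) * prob p (G.typeC g a b c d j) else 0) ≤
    (∑ i : Fin 3, ∑ j : Fin 3, if i ≠ j then
        prob p (G.typeA g a b c d i) * prob p (G.typeB g a b c d j) else 0) +
      (∑ i : Fin 3, prob p (G.typeA g a b c d i) * prob p (G.typeD g a b c d i)) +
      (∑ i : Fin 3, prob p (G.typeA g a b c d i)) * prob p (G.typeE g a b c d) +
      (∑ i : Fin 3, ∑ j : Fin 3, if i ≠ j then
        prob p (G.typeC g a b c d i) * prob p (G.typeD g a b c d j) else 0) +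
      (1 / 2 : ℝ) * (∑ i : Fin 3, ∑ j : Fin 3, if i ≠ j then
        prob p (G.typeD g a b c d i) * prob p (G.typeD g a b c d j) else 0) := by
  have h5a := ha G p hp a b c d hn g hg
  have h5b := hb G p hp a b c d hn g hg
  have hC : ∀ i, prob p (G.typeC g a b c d i) =
      prob p (G.typeCa g a b c d i) + prob p (G.typeCv g a b c d i) := fun i => by
    rw [G.typeC_eq_union, prob_union_of_disjoint p (G.disjoint_typeCa_typeCv g a b c d i)]
  have hE : prob p (G.typeE g a b c d) =
      prob p (G.typeEa g a b c d) + prob p (G.typeEv g a b c d) := by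
    rw [G.typeE_eq_union, prob_union_of_disjoint p (G.disjoint_typeEa_typeEv g a b c d)]
  simp only [Fin.sum_univ_three, hC, hE] at h5a h5b ⊢
  simp only [ne_eq, Fin.reduceEq, not_false_eq_true, if_true, if_false, not_true_eq_false,
    zero_add, add_zero] at h5a h5b ⊢
  nlinarith [h5a, h5b]

/-- **Lemma 5 = Lemma 5a + Lemma 5b**: the edges with `G.snd g = a` are handled by flipping the
orientation of `g` (the types `A`–`E` are flip-invariant). -/
theorem Concavity5Mark_of_5a_5b (ha : Concavity5a) (hb : Concavity5b) : Concavity5Mark := by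
  intro V E _ _ G p hp a b c d hn g hg
  rcases hg with hg | hg
  · exact concavity5_of_5a_5b_fst ha hb G p hp a b c d hn g hg
  · have key := concavity5_of_5a_5b_fst ha hb (G.flipEdge g) p hp a b c d hn g
      (by rw [MultiGraph.flipEdge_fst_self, hg])
    simpa only [MultiGraph.flipEdge_typeA, MultiGraph.flipEdge_typeB, MultiGraph.flipEdge_typeC,
      MultiGraph.flipEdge_typeD, MultiGraph.flipEdge_typeE] using key

end PercRepro
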